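import Literature.AlgebraicGeometry.Modules.FittingIdealSheafOfModule
import Literature.AlgebraicGeometry.Modules.KernelFiniteLocallyFree
import Literature.AlgebraicGeometry.Modules.RankOneCocycle
import Literature.RingTheory.FittingIdeal.LocallyFreeRankLocus
import Literature.RingTheory.FittingIdeal.FreeModule
import HarnessLib

/-!
# A quasi-coherent finite-type module has rank `r` iff `Fit_{r-1} = 0` and `Fit_r = 𝒪` (Stacks 0C3G)

Topic `Literature/AlgebraicGeometry/Modules`, namespace `Literature.AlgebraicGeometry.Modules`.  THEOREMS ONLY (no
definition, no instance, no notation, no named fact, no `sorry`).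

The Stacks Project, Tag 0C3G (Divisors, Lemma 31.9.5): "Let `S` be a scheme. Let `F` be a finite type, quasi-coherent
`𝒪_S`-module. Let `r ≥ 0`. The following are equivalent (1) `F` is finite locally free of rank `r` (2) `Fit_{r-1}(F) = 0`
and `Fit_r(F) = 𝒪_S`, and (3) `Fit_k(F) = 0` for `k < r` and `Fit_k(F) = 𝒪_S` for `k ≥ r`. Proof. Follows immediately
from More on Algebra, Lemma 15.8.8."  Here (1) is the tree's vector-bundle currency `Motives.HasRank E r` (local frames
`𝒪^{I} ≅ E|_U` with `#I = r` on an open cover) and the Fitting ideal sheaves are ★ `Modules/FittingIdealSheafOfModule`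
(`fittingIdealSheaf E hE hfin k`, `E` affine-localizing of affine-finite type):

* §1 (1) ⇒ (3): `fittingIdeal_sections_of_frame` (on an open carrying a frame of size `r`, `Fit_k(Γ(W, E))` is `Γ(W, 𝒪)`
  or `0` according as `r ≤ k` or not — ★ Stacks 07Z7 `Module.fittingIdeal_of_basis`), **`fittingIdealSheaf_of_hasRank`**
  (`HasRank E r → Fit_r(E) = 𝒪 ∧ ∀ k < r, Fit_k(E) = 0`; an ideal sheaf datum is determined on a covering family of
  affine opens, Mathlib `IdealSheafData.ext_of_iSup_eq_top`).
* §2 (2) ⇒ (1): **`hasRank_of_fittingIdealSheaf`** — over an affine `V ∋ x`, `Γ(V, E)` satisfies the Fitting conditions,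
  so it is free of rank `r` on some `D(f) ∋ x` (★ Stacks 07ZD/07ZC `Module.exists_nonempty_basis_away_of_fittingIdeal`);
  its basis frames `E` on `D(f)` (★ `nonempty_basis_sections_basicOpen`, ★ `nonempty_free_iso_over_of_basis`), and these
  frames form a `FrameSystem` of constant rank `r` (★ `FrameSystem.hasRank`).
* §3 **`hasRank_iff_fittingIdealSheaf`** (0C3G) and the pull-back corollary **`hasRank_pullback_iff`**: for `f : T → S`,
  `f^*E` has rank `r` iff `Fit_r(E) ⊆`-condition… precisely iff `Set.range f ⊆ S ∖ Z_r` and `Fit_k(E) ≤ ker f` for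
  `k < r` (★ `fittingIdealSheaf_pullback_eq_top_iff` / `_eq_bot_iff`, Stacks 0C3D) — the membership rule of the strata
  of ★ `Modules/LocallyFreeRankLocusRepresentable` in vector-bundle currency.

Cell `hodgecm-mathlib` (D-0151) count-neutral Mathlib-side capital (F-DAG F-5 (5b)/(5d)); nothing here is about HC —
HC_CM is proved only modulo the 7 printed citations until rung 0 closes.

## References

* The Stacks Project, Tags 0C3G, 05P8, 0C3D (Divisors §31.9), 07ZD, 07Z7 (More on Algebra §15.8). [StacksProject]
* U. Görtz, T. Wedhorn, *Algebraic Geometry I*, 2nd ed. (2020), Cor. 7.42. [GortzWedhorn2020]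
-/

noncomputable section

-- `TopCat.Presheaf`/`Scheme.Modules` are not reducible (as in Mathlib's `AlgebraicGeometry/Modules`).
set_option backward.isDefEq.respectTransparency false

open CategoryTheory AlgebraicGeometry TopologicalSpace Opposite

universe u

namespace Literature.AlgebraicGeometry.Modules

open Literature.RingTheory.FittingIdeal Literature.AlgebraicGeometry.Motives

variable {X : Scheme.{u}} {E : X.Modules} (hE : IsAffineLocalizing E) (hfin : IsAffineFiniteType E)

/-! ## §1 Frames force the Fitting conditions -/

/-- **Fitting ideals of a framed module** (Stacks 07Z7 on sections): if `E|_U ≅ 𝒪^I` with `#I = r`, then over every open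
`W ⊆ U` one has `Fit_k(Γ(W, E)) = Γ(W, 𝒪_X)` for `r ≤ k` and `= 0` for `k < r`. [cite: StacksProject, Tag 07Z7]
[cite: StacksProject, Tag 0C3G] -/
theorem fittingIdeal_sections_of_frame {U W : X.Opens} {I : Type u} [Finite I] {r : ℕ} (hI : Nat.card I = r)
    (e : SheafOfModules.free I ≅ E.over U) (hWU : W ≤ U) (k : ℕ) :
    Module.fittingIdeal Γ(X, W) Γ(E, W) k = if r ≤ k then ⊤ else ⊥ := by
  classical
  haveI := Fintype.ofFinite I
  obtain ⟨b⟩ := nonempty_basis_of_frame (SheafOfModules.restrictTrivialisation (R := X.ringCatSheaf) (homOfLE hWU) e)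
  have hcard : Fintype.card I = r := by rw [← hI, Nat.card_eq_fintype_card]
  rw [Module.fittingIdeal_of_basis (b.reindex (Fintype.equivFinOfCardEq hcard)) k]

/-- **Stacks 0C3G, (1) ⇒ (3)**: a module of rank `r` (affine-localizing, of affine-finite type) has `Fit_r(E) = 𝒪_X` and
`Fit_k(E) = 0` for all `k < r`. [cite: StacksProject, Tag 0C3G] -/
theorem fittingIdealSheaf_of_hasRank {r : ℕ} (h : HasRank E r) :
    fittingIdealSheaf E hE hfin r = ⊤ ∧ ∀ k < r, fittingIdealSheaf E hE hfin k = ⊥ := by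
  obtain ⟨F, hF⟩ := exists_frameSystem_of_hasRank h
  -- the affine opens lying in some `U_x` cover `X`
  let ι := {W : X.affineOpens // ∃ x : X, (W : X.Opens) ≤ F.U x}
  have hcov : ⨆ W : ι, (W.1 : X.Opens) = ⊤ := by
    refine top_le_iff.mp fun x _ => ?_
    obtain ⟨W, hW, hxW, hWU⟩ := (Opens.isBasis_iff_nbhd.mp X.isBasis_affineOpens) (F.mem x)
    exact Opens.mem_iSup.mpr ⟨⟨⟨W, hW⟩, x, hWU⟩, hxW⟩
  have key : ∀ (W : ι) (k : ℕ), (fittingIdealSheaf E hE hfin k).ideal W.1 = if r ≤ k then ⊤ else ⊥ := by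
    rintro ⟨W, x, hWU⟩ k
    haveI : Finite (F.I x) := Finite.of_equiv _ (F.enum x).symm
    have hI : Nat.card (F.I x) = r := by rw [Nat.card_eq_of_equiv_fin (F.enum x), hF x]
    exact fittingIdeal_sections_of_frame hI (F.frame x) hWU k
  refine ⟨Scheme.IdealSheafData.ext_of_iSup_eq_top _ hcov fun W => ?_,
    fun k hk => Scheme.IdealSheafData.ext_of_iSup_eq_top _ hcov fun W => ?_⟩
  · rw [key W r, if_pos le_rfl, Scheme.IdealSheafData.ideal_top, Pi.top_apply]
  · rw [key W k, if_neg (not_le.mpr hk), Scheme.IdealSheafData.ideal_bot, Pi.bot_apply]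

/-! ## §2 The Fitting conditions frame the module -/

/-- **Stacks 0C3G, (2) ⇒ (1)**: if `Fit_r(E) = 𝒪_X` and `Fit_k(E) = 0` for `k < r` (`E` affine-localizing of
affine-finite type), then `E` has rank `r`: every point has a basic open neighbourhood of an affine open over which
`E ≅ 𝒪^r` (★ 07ZD `Module.exists_nonempty_basis_away_of_fittingIdeal` on `Γ(V, E)`, then the sections basis frames the
affine-localizing module). [cite: StacksProject, Tag 0C3G] [cite: GortzWedhorn2020, Cor. 7.42] -/
theorem hasRank_of_fittingIdealSheaf {r : ℕ} (htop : fittingIdealSheaf E hE hfin r = ⊤)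
    (hbot : ∀ k < r, fittingIdealSheaf E hE hfin k = ⊥) : HasRank E r := by
  classical
  have key : ∀ x : X, ∃ (U : X.Opens) (_ : x ∈ U), Nonempty (SheafOfModules.free (ULift.{u} (Fin r)) ≅ E.over U) := by
    intro x
    obtain ⟨_, ⟨V, hV, rfl⟩, hxV, -⟩ :=
      X.isBasis_affineOpens.exists_subset_of_mem_open (Set.mem_univ x) isOpen_univ
    haveI : Module.Finite Γ(X, V) Γ(E, V) := hfin hV
    have htopV : Module.fittingIdeal Γ(X, V) Γ(E, V) r = ⊤ := by
      rw [← ideal_fittingIdealSheaf hE hfin r ⟨V, hV⟩, htop, Scheme.IdealSheafData.ideal_top, Pi.top_apply]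
    have hbotV : ∀ k < r, Module.fittingIdeal Γ(X, V) Γ(E, V) k = ⊥ := fun k hk => by
      rw [← ideal_fittingIdealSheaf hE hfin k ⟨V, hV⟩, hbot k hk, Scheme.IdealSheafData.ideal_bot, Pi.bot_apply]
    obtain ⟨f, hf, ⟨b⟩⟩ := Module.exists_nonempty_basis_away_of_fittingIdeal htopV hbotV (hV.primeIdealOf ⟨x, hxV⟩)
    obtain ⟨bD⟩ := nonempty_basis_sections_basicOpen hE hV f (b.reindex Equiv.ulift.symm)
    obtain ⟨e⟩ := nonempty_free_iso_over_of_basis E hE (hV.basicOpen f) bD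
    exact ⟨X.basicOpen f, (mem_basicOpen_iff_not_mem_primeIdealOf hV f hxV).mpr hf, ⟨e⟩⟩
  choose U hU e using key
  exact FrameSystem.hasRank
    { U := U
      mem := hU
      I := fun _ => ULift.{u} (Fin r)
      rank := fun _ => r
      enum := fun _ => Equiv.ulift
      frame := fun x => (e x).some } r fun _ => rfl

/-! ## §3 Stacks 0C3G and its pull-back form -/

/-- **Stacks, Tag 0C3G (Divisors, Lemma 31.9.5)**: an affine-localizing (= quasi-coherent) `𝒪_X`-module of affine-finite
type is finite locally free of rank `r` (`HasRank E r`) iff `Fit_r(E) = 𝒪_X` and `Fit_k(E) = 0` for all `k < r`.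
[cite: StacksProject, Tag 0C3G] -/
theorem hasRank_iff_fittingIdealSheaf (r : ℕ) :
    HasRank E r ↔ fittingIdealSheaf E hE hfin r = ⊤ ∧ ∀ k < r, fittingIdealSheaf E hE hfin k = ⊥ :=
  ⟨fittingIdealSheaf_of_hasRank hE hfin, fun h => hasRank_of_fittingIdealSheaf hE hfin h.1 h.2⟩

/-- **Stacks 0C3G in module currency**: `E` has rank `r` iff over every affine open `V` the sections `Γ(V, E)` form a
finite projective `Γ(V, 𝒪_X)`-module of constant rank `r` (the currency of Mathlib's `Module.Grassmannian`).
[cite: StacksProject, Tag 0C3G] [cite: GortzWedhorn2020, Cor. 7.42] -/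
theorem hasRank_iff_forall_projective_rankAtStalk (hE : IsAffineLocalizing E) (hfin : IsAffineFiniteType E) (r : ℕ) :
    HasRank E r ↔ ∀ V : X.affineOpens, Module.Projective Γ(X, V) Γ(E, V) ∧
      ∀ p : PrimeSpectrum Γ(X, V), Module.rankAtStalk Γ(E, V) p = r := by
  rw [hasRank_iff_fittingIdealSheaf hE hfin r]
  constructor
  · rintro ⟨htop, hbot⟩ V
    haveI : Module.Finite Γ(X, V) Γ(E, V) := hfin V.2
    refine Module.projective_and_rankAtStalk_eq_iff_fittingIdeal.mpr ⟨?_, fun k hk => ?_⟩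
    · rw [← ideal_fittingIdealSheaf hE hfin r V, htop, Scheme.IdealSheafData.ideal_top, Pi.top_apply]
    · rw [← ideal_fittingIdealSheaf hE hfin k V, hbot k hk, Scheme.IdealSheafData.ideal_bot, Pi.bot_apply]
  · intro h
    have h' : ∀ V : X.affineOpens, Module.fittingIdeal Γ(X, V) Γ(E, V) r = ⊤ ∧
        ∀ k < r, Module.fittingIdeal Γ(X, V) Γ(E, V) k = ⊥ := fun V => by
      haveI : Module.Finite Γ(X, V) Γ(E, V) := hfin V.2
      exact Module.projective_and_rankAtStalk_eq_iff_fittingIdeal.mp (h V)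
    exact ⟨Scheme.IdealSheafData.ext (funext fun V => by
        rw [ideal_fittingIdealSheaf, (h' V).1, Scheme.IdealSheafData.ideal_top, Pi.top_apply]),
      fun k hk => Scheme.IdealSheafData.ext (funext fun V => by
        rw [ideal_fittingIdealSheaf, (h' V).2 k hk, Scheme.IdealSheafData.ideal_bot, Pi.bot_apply])⟩

/-- **The rank-`r` stratum in vector-bundle currency** (Stacks 05P8 (3) membership rule via 0C3D): for `f : T → X`,
the inverse image `f^*E` has rank `r` iff `f(T)` misses `Z_r = Supp(𝒪_X/Fit_r(E))` and `Fit_k(E) ⊆ ker f` for all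
`k < r`. [cite: StacksProject, Tag 05P8] [cite: StacksProject, Tag 0C3D] -/
theorem hasRank_pullback_iff {T : Scheme.{u}} (f : T ⟶ X) (r : ℕ) :
    HasRank ((Scheme.Modules.pullback f).obj E) r ↔
      Set.range f.base ⊆ ((fittingIdealSheaf E hE hfin r).support : Set X)ᶜ ∧
        ∀ k < r, fittingIdealSheaf E hE hfin k ≤ f.ker := by
  rw [hasRank_iff_fittingIdealSheaf (hE.pullback f) (hfin.pullback f hE) r, fittingIdealSheaf_pullback_eq_top_iff]
  refine and_congr_right fun _ => forall₂_congr fun k _ => ?_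
  rw [fittingIdealSheaf_pullback_eq_bot_iff]

/-- Under the rank-`r` Fitting conditions, every pull-back has rank `r` (ranks are stable under base change).
[cite: StacksProject, Tag 0C3D] -/
theorem hasRank_pullback_of_hasRank (hE : IsAffineLocalizing E) (hfin : IsAffineFiniteType E) {T : Scheme.{u}}
    (f : T ⟶ X) {r : ℕ} (h : HasRank E r) :
    HasRank ((Scheme.Modules.pullback f).obj E) r := by
  obtain ⟨htop, hbot⟩ := fittingIdealSheaf_of_hasRank hE hfin h
  refine (hasRank_pullback_iff hE hfin f r).mpr ⟨?_, fun k hk => ?_⟩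
  · have hs : (fittingIdealSheaf E hE hfin r).support = ⊥ := by
      rw [Scheme.IdealSheafData.support_eq_bot_iff]; exact htop
    rw [hs, Closeds.coe_bot, Set.compl_empty]
    exact Set.subset_univ _
  · rw [hbot k hk]
    exact bot_le

end Literature.AlgebraicGeometry.Modules

end
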